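/-
Copyright (c) 2026 the pub-hodgecm-mathlib formalisation cell (harness21).  Prover seat hodgecm-mathlib-LH4-p10 (g6): Track A «(D-RAM) FOUR-FRAME» squad of crux H413, STAGE-1b,
(β-BAL) road — dealer LH4-plan (g13) WORD #82 (B) «B2a-2», LH4-p11 (g8) SIG `SIG-B2a2-labelledOddFibre.v1` dbcde430.  2026-09-04.
-/
import Summits.HodgeConjecture.HodgeConjecture.Theorems.F0P3cDyRamLabelledOddCountDefs          -- DEFS (LH4-p11 (g8)): `IsTorusEquivariantLabel`, `polarisationNormClasses`, `classLabelSign`, `labelledOddCount`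
import Summits.HodgeConjecture.HodgeConjecture.Theorems.F0P3cDyRamDiagonalKappaOrbitFibreCount   -- ★ (Oκ2b) (LH4-p14 lineage): brings ★ (O2b) `…OrbitFibreCount` steps, `…OrbitFibreTransport`, `…TorusRepresentativesCount`, `…PairReindex`, `…KappaCountEval`
import Mathlib.Tactic.FieldSimp
import Mathlib.Tactic.LinearCombination
import HarnessLib

/-!
# Crux `H413`, line LH4 «(D-RAM) FOUR-FRAME» — (β-BAL) road, brick B2a-2 FILE 1∕3: THE LABELLED FIBRE OVER ONE ORBIT MEMBER (★ (O2b) Steps 1–3 with a torus-equivariant label)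

Cell `hodgecm-mathlib` (D-0151), FLOOR 0, crux item H413 = `stmt-HodgeConjecture-24833`, route `HCCMUnconditional`; squad F0∕P3c∕LH4.  THEOREMS ONLY; lane
`--supports stmt-HodgeConjecture-24833 --as helper` (count-neutral).

WHAT.  The twin of ★ (Oκ2b) `F0P3cDyRamDiagonalKappaOrbitFibreCount.sum_signChar_mul_finsum_ncard_fibre_mul_relIndex_eq` with a TORUS-EQUIVARIANT LABEL `Λ` on (lattice, form)
pairs (`Λ(diag(z)M, D) ↔ Λ(M, D·N(z))`, LH4-p11 (g8)'s DEFS `IsTorusEquivariantLabel`): along the unit-torus orbit of `M₀`,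
`(Σ_e (−1)^{e_i} · Σᶠ_{M ∈ 𝒯·M₀} #{a : diag(ϖu^a)M is a type-tv vertex of diag(d_e) ∧ Λ(diag(ϖu^a)M, d_e)}) · [𝒰 : N(S̃(M₀) ∩ 𝒯)] = 8 · [𝒯 : S̃(M₀) ∩ 𝒯] · labelledOddCount σ ϖ tv i Λ M₀`
— statement = LH4-p11 (g8) SIG (B2a-2) v1 §1 TOKEN FOR TOKEN.
PROOF.  ★ (O2b) Steps 1–4 with the label riding along (by `hΛ` at `z = ϖu^a·u` the labelled fibre over `diag(u)M₀` is `{a₀}` iff `s(e,u) := d_e·N(u)·w⁻¹ ∈ S_F(M₀)` AND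
`Λ M₀ (D₁·s(e,u))`, a condition constant on the `S̃`-coset of `u`); then, with `H := 𝒯 ⊓ N⁻¹(S_F)`, `H₀ := 𝒯 ⊓ N⁻¹(N S̃)` (`S̃ ≤ H₀ ≤ H`): for a good `e` the labelled orbit set is a
disjoint union over the `H₀`-cosets `h̄` of `H` with `Λ M₀ (D₁·s₀(e)·N h)` of translates of the `H₀`-orbit, each of size `[H₀ : S̃]`; the pairs `(e good, h̄)` are in bijection with
`polarisationNormClasses σ ϖ tv M₀` (classes `D·N(S̃)`), on which the sign is `ω(D_i) = (−1)^{e_i}` (norms are `ω`-trivial) and `Λ` is constant — so the signed labelled count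
is `[H₀ : S̃] · labelledOddCount`; finally `[H₀ : S̃]·[𝒰 : N S̃] = 8·[𝒯 : S̃]` (`N : 𝒯∕H₀ ≅ N𝒯∕N S̃`, ★ `h8`).
HONEST LABEL.  Count-neutral; pays no tier-0 row (the eightfold vanishing ∕ (β-BAL) ∕ `stub_law_cleanSgn` stay OPEN until LH4-p11's B2a-3 and LH4-p05's END land); `HC_CM`
is proved only modulo the 7 printed citations (2 remaining named inputs: hLiu418 = `stmt-HodgeConjecture-24832`, h413 = `stmt-HodgeConjecture-24833`) until rung 0 closes.

## References
* [Kottwitz1986BaseChangeUnits] R. E. Kottwitz, *Base change for unit elements of Hecke algebras*, Compositio Math. 60 (1986), §1 pp. 240–241.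
* [Rogawski1990] J. D. Rogawski, *Automorphic Representations of Unitary Groups in Three Variables*, Ann. of Math. Stud. 123 (1990), §4.9 Prop. 4.9.1 (a)(b) p. 55, §4.10 p. 58.
* [LanglandsShelstad1987] R. P. Langlands, D. Shelstad, *On the definition of transfer factors*, Math. Ann. 278 (1987), §3.
* [Serre1979] J.-P. Serre, *Local Fields*, GTM 67 (1979), Ch. V §3 Cor. 3.
-/

set_option autoImplicit false

noncomputable section

namespace Summit.HodgeConjecture.HodgeConjecture.Cruxes.H413.F0P3cDyRamDiagonalLabelledOddFibreStep

open Literature.NumberTheory.Automorphic Literature.NumberTheory.Automorphic.HermitianLattice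
open Literature.NumberTheory.Automorphic.UnitaryLatticeTree Literature.NumberTheory.Automorphic.UnitaryThreeFourFrame
open Summit.HodgeConjecture.HodgeConjecture.Cruxes.H413.F0P3cDyRamDiagonalTorusDefs
open Summit.HodgeConjecture.HodgeConjecture.Cruxes.H413.F0P3cDyRamDiagonalOrbitFibreTransport
open Summit.HodgeConjecture.HodgeConjecture.Cruxes.H413.F0P3cDyRamTorusRepresentativesCount
open Summit.HodgeConjecture.HodgeConjecture.Cruxes.H413.F0P3cDyRamDiagonalPairReindex
open Summit.HodgeConjecture.HodgeConjecture.Cruxes.H413.F0P3cDyRamDiagonalOrbitFibreCount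
open Summit.HodgeConjecture.HodgeConjecture.Cruxes.H413.F0P3cDyRamDiagonalKappaCountEval (normSign_ite_mul_norm)
open Summit.HodgeConjecture.HodgeConjecture.Cruxes.H413.F0P3cDyRamLabelledOddCountDefs
open scoped Valued WithZero Matrix MatrixGroups

variable {K : Type} [Field K] [Valued K ℤᵐ⁰]

/-! ## §1  Step 1 of ★ (O2b) as a lemma: `N(S̃(M₀) ∩ 𝒯) ≤ S_F(M₀)` under the one-coset property -/

/-- **★ (O2b) STEP 1**: if the type-`tv` polarisations of `M₀` form one `S_F(M₀)`-coset `D₁·S_F(M₀)` (`hcoset`), then the norms of the unit diagonal stabiliser lie in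
the fixed stabiliser: `N(S̃(M₀) ∩ 𝒯) ≤ S_F(M₀)` (`diag(t)M₀ = M₀` ⇒ `M₀` is a vertex of `diag(D₁·N t)` ⇒ `N t ∈ S_F`). [cite: Kottwitz1986BaseChangeUnits, §1 pp. 240–241] -/
theorem map_unitNormMap_unitStabilizer_le {σ : K →+* K} (hσ : ∀ x, σ (σ x) = x) {ϖ : K} {M₀ : Submodule 𝒪[K] (Fin 3 → K)} (tv : ℕ)
    (hcoset : ∀ D₁ : Fin 3 → K, (∀ i, σ (D₁ i) = D₁ i ∧ D₁ i ≠ 0) → IsVertexLattice σ ϖ (Matrix.diagonal D₁) tv M₀ →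
      ∀ D : Fin 3 → K, (∀ i, σ (D i) = D i ∧ D i ≠ 0) →
        (IsVertexLattice σ ϖ (Matrix.diagonal D) tv M₀ ↔ ∃ u ∈ fixedUnitStabilizer σ M₀, ∀ i, D i = D₁ i * (u i : Kˣ)))
    {D₁ : Fin 3 → K} (hD₁ : ∀ i, σ (D₁ i) = D₁ i ∧ D₁ i ≠ 0) (hV₁ : IsVertexLattice σ ϖ (Matrix.diagonal D₁) tv M₀) :
    (unitStabilizer M₀).map (unitNormMap σ 3) ≤ fixedUnitStabilizer σ M₀ := by
  rintro _ ⟨t, ht, rfl⟩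
  have ht' := Subgroup.mem_inf.1 ht
  have htS : mapGL (diagGLUnits t) M₀ = M₀ := (mem_latticeStabilizer_iff M₀ t).1 ht'.1
  have hV' : IsVertexLattice σ ϖ (Matrix.diagonal D₁) tv (mapGL (diagGLUnits t) M₀) := by rw [htS]; exact hV₁
  rw [isVertexLattice_diagonal_mapGL_diagGLUnits_iff] at hV'
  have hDfix : ∀ i, σ (D₁ i * ((t i : K) * σ (t i))) = D₁ i * ((t i : K) * σ (t i)) ∧ D₁ i * ((t i : K) * σ (t i)) ≠ 0 := fun i =>
    ⟨by rw [map_mul, map_mul, (hD₁ i).1, hσ, mul_comm (σ (t i : K))],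
      mul_ne_zero (hD₁ i).2 (mul_ne_zero (t i).ne_zero ((map_ne_zero σ).2 (t i).ne_zero))⟩
  obtain ⟨u, huSF, hu⟩ := (hcoset D₁ hD₁ hV₁ _ hDfix).1 hV'
  have heq : unitNormMap σ 3 t = u := funext fun i => Units.ext (by
    rw [unitNormMap_apply]; exact mul_left_cancel₀ (hD₁ i).2 (hu i))
  rw [heq]; exact huSF

/-- **A TORUS-EQUIVARIANT LABEL IS CONSTANT UNDER `D ↦ D·N(t)`, `t ∈ S̃(M₀) ∩ 𝒯`**: `Λ(M₀, D·N t) ↔ Λ(diag(t)M₀, D) = Λ(M₀, D)`.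
[cite: Kottwitz1986BaseChangeUnits, §1 pp. 240–241] -/
theorem label_mul_unitNormMap_iff {σ : K →+* K} {M₀ : Submodule 𝒪[K] (Fin 3 → K)}
    (Λ : Submodule 𝒪[K] (Fin 3 → K) → (Fin 3 → K) → Prop) (hΛ : IsTorusEquivariantLabel σ Λ)
    (D : Fin 3 → K) {t : Fin 3 → Kˣ} (ht : t ∈ unitStabilizer M₀) :
    Λ M₀ (fun j => D j * ((unitNormMap σ 3 t j : Kˣ) : K)) ↔ Λ M₀ D := by
  have htS : mapGL (diagGLUnits t) M₀ = M₀ := (mem_latticeStabilizer_iff M₀ t).1 (Subgroup.mem_inf.1 ht).1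
  have h := hΛ t M₀ D
  rw [htS] at h
  simp only [unitNormMap_apply]
  exact h.symm

/-! ## §2  The letters `s(e,u) = c^e·N(u)·w⁻¹`, `pol(e,u) = D₁·s(e,u)` of the labelled fibre -/

omit [Valued K ℤᵐ⁰] in
/-- `pol(e,u)_j = c^{e_j} · N((ϖu^{a₀}·u)_j)` when `D₁ = N(ϖu^{a₀})·w`. [cite: Kottwitz1986BaseChangeUnits, §1 pp. 240–241] -/
theorem pol_apply_eq (σ : K →+* K) (ϖu : Kˣ) {c : K} (cU : Kˣ) (hcU : (cU : K) = c) {D₁ : Fin 3 → K} {a₀ : Fin 3 → ℤ} {w : Fin 3 → Kˣ}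
    (hD₁w : ∀ i, D₁ i = ((unitNormMap σ 3 (fun j => ϖu ^ a₀ j) i : Kˣ) : K) * ((w i : Kˣ) : K))
    (cvec : (Fin 3 → Bool) → (Fin 3 → Kˣ)) (hcvec : ∀ e, cvec e = fun j => if e j then cU else 1)
    (sEU : (Fin 3 → Bool) → (Fin 3 → Kˣ) → (Fin 3 → Kˣ)) (hsEU : ∀ e u, sEU e u = cvec e * unitNormMap σ 3 u * w⁻¹)
    (pol : (Fin 3 → Bool) → (Fin 3 → Kˣ) → (Fin 3 → K)) (hpol : ∀ e u j, pol e u j = D₁ j * ((sEU e u j : Kˣ) : K))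
    (e : Fin 3 → Bool) (u : Fin 3 → Kˣ) (j : Fin 3) :
    pol e u j = (if e j then c else (1 : K)) * ((((fun k => ϖu ^ a₀ k) * u) j : Kˣ) * σ ((((fun k => ϖu ^ a₀ k) * u) j : Kˣ) : K)) := by
  have hw0 : ((w j : Kˣ) : K) ≠ 0 := Units.ne_zero _
  have hcvec_val : ((cvec e j : Kˣ) : K) = if e j then c else 1 := by
    rw [hcvec]; by_cases h : e j <;> simp [h, hcU]
  simp only [hpol, hsEU, Pi.mul_apply, Pi.inv_apply, Units.val_mul, Units.val_inv_eq_inv_val, unitNormMap_apply, hcvec_val, map_mul, hD₁w j]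
  field_simp

omit [Valued K ℤᵐ⁰] in
/-- `s(e, u·t) = s(e,u)·N(t)`. [cite: Kottwitz1986BaseChangeUnits, §1 pp. 240–241] -/
theorem sEU_mul (σ : K →+* K) {w : Fin 3 → Kˣ} (cvec : (Fin 3 → Bool) → (Fin 3 → Kˣ))
    (sEU : (Fin 3 → Bool) → (Fin 3 → Kˣ) → (Fin 3 → Kˣ)) (hsEU : ∀ e u, sEU e u = cvec e * unitNormMap σ 3 u * w⁻¹)
    (e : Fin 3 → Bool) (u t : Fin 3 → Kˣ) : sEU e (u * t) = sEU e u * unitNormMap σ 3 t := by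
  rw [hsEU, hsEU, map_mul]
  refine funext fun j => Units.ext ?_
  simp only [Pi.mul_apply, Pi.inv_apply, Units.val_mul, Units.val_inv_eq_inv_val]
  ring

omit [Valued K ℤᵐ⁰] in
/-- `pol(e, u·t)_j = pol(e,u)_j · N(t)_j`. [cite: Kottwitz1986BaseChangeUnits, §1 pp. 240–241] -/
theorem pol_mul (σ : K →+* K) {D₁ : Fin 3 → K} {w : Fin 3 → Kˣ} (cvec : (Fin 3 → Bool) → (Fin 3 → Kˣ))
    (sEU : (Fin 3 → Bool) → (Fin 3 → Kˣ) → (Fin 3 → Kˣ)) (hsEU : ∀ e u, sEU e u = cvec e * unitNormMap σ 3 u * w⁻¹)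
    (pol : (Fin 3 → Bool) → (Fin 3 → Kˣ) → (Fin 3 → K)) (hpol : ∀ e u j, pol e u j = D₁ j * ((sEU e u j : Kˣ) : K))
    (e : Fin 3 → Bool) (u t : Fin 3 → Kˣ) (j : Fin 3) : pol e (u * t) j = pol e u j * ((unitNormMap σ 3 t j : Kˣ) : K) := by
  rw [hpol, hpol, sEU_mul σ cvec sEU hsEU, Pi.mul_apply, Units.val_mul, mul_assoc]

/-! ## §3  ★ (O2b) Step 2 with the label: the labelled fibre over `diag(u)·M₀` -/

/-- **THE LABELLED FIBRE OVER ONE ORBIT MEMBER** (★ (O2b) Step 2 + the label transported by `hΛ` at `z = ϖu^a·u`): for `u ∈ 𝒯`, sign `e` and `a ∈ ℤ³`,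
`diag(ϖu^a)·diag(u)M₀` is a type-`tv` vertex of `diag(d_e)` carrying the label iff `a = a₀`, `s(e,u) ∈ S_F(M₀)` and `Λ(M₀, pol(e,u))`.
[cite: Kottwitz1986BaseChangeUnits, §1 pp. 240–241] [cite: Rogawski1990, §4.9 Prop. 4.9.1 (a) p. 55] -/
theorem labelledFibre_iff {σ : K →+* K} (hσ : ∀ x, σ (σ x) = x) (hvσ : ∀ a, Valued.v (σ a) = Valued.v a)
    {ϖ : K} (hϖ : Valued.v ϖ = WithZero.exp (-1 : ℤ)) (ϖu : Kˣ) (hϖu : (ϖu : K) = ϖ)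
    {c : K} (hσc : σ c = c) (hcv : Valued.v c = 1) (cU : Kˣ) (hcU : (cU : K) = c) {M₀ : Submodule 𝒪[K] (Fin 3 → K)} (tv : ℕ)
    (hcoset : ∀ D₁ : Fin 3 → K, (∀ i, σ (D₁ i) = D₁ i ∧ D₁ i ≠ 0) → IsVertexLattice σ ϖ (Matrix.diagonal D₁) tv M₀ →
      ∀ D : Fin 3 → K, (∀ i, σ (D i) = D i ∧ D i ≠ 0) →
        (IsVertexLattice σ ϖ (Matrix.diagonal D) tv M₀ ↔ ∃ u ∈ fixedUnitStabilizer σ M₀, ∀ i, D i = D₁ i * (u i : Kˣ)))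
    {D₁ : Fin 3 → K} (hD₁ : ∀ i, σ (D₁ i) = D₁ i ∧ D₁ i ≠ 0) (hV₁ : IsVertexLattice σ ϖ (Matrix.diagonal D₁) tv M₀)
    {a₀ : Fin 3 → ℤ} {w : Fin 3 → Kˣ} (hwU : w ∈ fixedUnitTorus σ 3)
    (hD₁w : ∀ i, D₁ i = ((unitNormMap σ 3 (fun j => ϖu ^ a₀ j) i : Kˣ) : K) * ((w i : Kˣ) : K))
    (Λ : Submodule 𝒪[K] (Fin 3 → K) → (Fin 3 → K) → Prop) (hΛ : IsTorusEquivariantLabel σ Λ)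
    (cvec : (Fin 3 → Bool) → (Fin 3 → Kˣ)) (hcvec : ∀ e, cvec e = fun j => if e j then cU else 1)
    (sEU : (Fin 3 → Bool) → (Fin 3 → Kˣ) → (Fin 3 → Kˣ)) (hsEU : ∀ e u, sEU e u = cvec e * unitNormMap σ 3 u * w⁻¹)
    (pol : (Fin 3 → Bool) → (Fin 3 → Kˣ) → (Fin 3 → K)) (hpol : ∀ e u j, pol e u j = D₁ j * ((sEU e u j : Kˣ) : K))
    {u : Fin 3 → Kˣ} (hu : u ∈ unitTorus K 3) (e : Fin 3 → Bool) (a : Fin 3 → ℤ) :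
    (IsVertexLattice σ ϖ (Matrix.diagonal fun i => if e i then c else (1 : K)) tv
        (mapGL (diagGLUnits fun i => ϖu ^ a i) (mapGL (diagGLUnits u) M₀)) ∧
      Λ (mapGL (diagGLUnits fun i => ϖu ^ a i) (mapGL (diagGLUnits u) M₀)) (fun j => if e j then c else (1 : K))) ↔
      a = a₀ ∧ (sEU e u ∈ fixedUnitStabilizer σ M₀ ∧ Λ M₀ (pol e u)) := by
  have upi : ∀ {x y : Fin 3 → Kˣ}, (∀ i, ((x i : Kˣ) : K) = y i) → x = y := fun h => funext fun i => Units.ext (h i)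
  have hcvec_val : ∀ i, ((cvec e i : Kˣ) : K) = if e i then c else 1 := by
    intro i; rw [hcvec]; by_cases h : e i <;> simp [h, hcU]
  have hc0 : c ≠ 0 := fun h => by simp [h] at hcv
  have hcvec_ne : ∀ i, (if e i then c else (1 : K)) ≠ 0 := by
    intro i; by_cases h : e i <;> simp [h, hc0]
  have hcvec_v : ∀ i, Valued.v (if e i then c else (1 : K)) = 1 := by
    intro i; by_cases h : e i <;> simp [h, hcv]
  have hcvec_fix : ∀ i, σ (if e i then c else (1 : K)) = if e i then c else 1 := by
    intro i; by_cases h : e i <;> simp [h, hσc]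
  have hwU' := (mem_fixedUnitTorus_iff σ w).1 hwU
  have hpol_eq := pol_apply_eq σ ϖu cU hcU hD₁w cvec hcvec sEU hsEU pol hpol e u
  rw [← mapGL_mul, ← map_mul, isVertexLattice_diagonal_mapGL_diagGLUnits_iff, hΛ]
  have hDfix : ∀ i, σ ((if e i then c else (1 : K)) * ((((fun j => ϖu ^ a j) * u) i : Kˣ) * σ (((fun j => ϖu ^ a j) * u) i : Kˣ)))
      = (if e i then c else (1 : K)) * ((((fun j => ϖu ^ a j) * u) i : Kˣ) * σ (((fun j => ϖu ^ a j) * u) i : Kˣ)) ∧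
      (if e i then c else (1 : K)) * ((((fun j => ϖu ^ a j) * u) i : Kˣ) * σ (((fun j => ϖu ^ a j) * u) i : Kˣ)) ≠ 0 := fun i =>
    ⟨by rw [map_mul, map_mul, hcvec_fix, hσ, mul_comm (σ _) (_ : K)],
      mul_ne_zero (hcvec_ne i) (mul_ne_zero (Units.ne_zero _) ((map_ne_zero σ).2 (Units.ne_zero _)))⟩
  rw [hcoset D₁ hD₁ hV₁ _ hDfix]
  have key : ∀ s : Fin 3 → Kˣ, (∀ i, (if e i then c else (1 : K)) * ((((fun j => ϖu ^ a j) * u) i : Kˣ) * σ (((fun j => ϖu ^ a j) * u) i : Kˣ))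
        = D₁ i * (s i : Kˣ)) ↔
      unitNormMap σ 3 (fun j => ϖu ^ a j) * (cvec e * unitNormMap σ 3 u) = unitNormMap σ 3 (fun j => ϖu ^ a₀ j) * (w * s) := by
    intro s
    constructor
    · intro h
      refine upi fun i => ?_
      have := h i
      rw [hD₁w i, unitNormMap_apply, Pi.mul_apply, Units.val_mul, map_mul] at this
      simp only [Pi.mul_apply, Units.val_mul, unitNormMap_apply, hcvec_val]
      linear_combination this
    · intro h i
      have := congrArg (fun f : Fin 3 → Kˣ => ((f i : Kˣ) : K)) h
      simp only [Pi.mul_apply, Units.val_mul, unitNormMap_apply, hcvec_val] at this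
      rw [hD₁w i, unitNormMap_apply, Pi.mul_apply, Units.val_mul, map_mul]
      linear_combination this
  have hfun : (fun j => (if e j then c else (1 : K)) * ((((fun k => ϖu ^ a₀ k) * u) j : Kˣ) * σ ((((fun k => ϖu ^ a₀ k) * u) j : Kˣ) : K))) = pol e u :=
    funext fun j => (hpol_eq j).symm
  constructor
  · rintro ⟨⟨s, hsSF, hs⟩, hL⟩
    rw [key] at hs
    have hsU := ((mem_fixedUnitStabilizer_iff σ M₀ s).1 hsSF).2.1
    have ha : a = a₀ := by
      funext i
      have := congrArg (fun f : Fin 3 → Kˣ => Valued.v ((f i : Kˣ) : K)) hs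
      simp only [Pi.mul_apply, Units.val_mul, map_mul] at this
      rw [hcvec_val, hcvec_v, v_unitNormMap_zpow hvσ hϖ ϖu hϖu, v_unitNormMap_of_mem_unitTorus hvσ hu,
        v_unitNormMap_zpow hvσ hϖ ϖu hϖu, hwU'.1 i, hsU i] at this
      simp only [mul_one, WithZero.exp_inj] at this
      omega
    rw [ha] at hs hL
    have hs2 : cvec e * unitNormMap σ 3 u = w * s := mul_left_cancel hs
    have hsid : sEU e u = s := by rw [hsEU, hs2, mul_inv_cancel_comm]
    refine ⟨ha, by rw [hsid]; exact hsSF, ?_⟩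
    rw [hfun] at hL
    exact hL
  · rintro ⟨ha, hmem, hL⟩
    rw [ha] at key ⊢
    refine ⟨⟨sEU e u, hmem, ?_⟩, ?_⟩
    · rw [key, hsEU, mul_inv_cancel_comm_assoc]
    · rw [hfun]; exact hL

/-! ## §4  ★ (O2b) Step 3 with the label: constancy along the `S̃`-coset; the labelled fibre size -/

/-- **THE LABELLED CONDITION IS CONSTANT ALONG THE `S̃`-COSET OF `u`**: if `diag(u)M₀ = diag(u')M₀` then `s(e,u) ∈ S_F ∧ Λ(M₀, pol(e,u))` transfers from `u` to `u'`
(`u⁻¹u' ∈ S̃ ∩ 𝒯`, Step 1, and the torus equivariance of `Λ`). [cite: Kottwitz1986BaseChangeUnits, §1 pp. 240–241] -/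
theorem labelledCond_of_mapGL_eq {σ : K →+* K} (hσ : ∀ x, σ (σ x) = x) {ϖ : K} {M₀ : Submodule 𝒪[K] (Fin 3 → K)} (tv : ℕ)
    (hcoset : ∀ D₁ : Fin 3 → K, (∀ i, σ (D₁ i) = D₁ i ∧ D₁ i ≠ 0) → IsVertexLattice σ ϖ (Matrix.diagonal D₁) tv M₀ →
      ∀ D : Fin 3 → K, (∀ i, σ (D i) = D i ∧ D i ≠ 0) →
        (IsVertexLattice σ ϖ (Matrix.diagonal D) tv M₀ ↔ ∃ u ∈ fixedUnitStabilizer σ M₀, ∀ i, D i = D₁ i * (u i : Kˣ)))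
    {D₁ : Fin 3 → K} (hD₁ : ∀ i, σ (D₁ i) = D₁ i ∧ D₁ i ≠ 0) (hV₁ : IsVertexLattice σ ϖ (Matrix.diagonal D₁) tv M₀) {w : Fin 3 → Kˣ}
    (Λ : Submodule 𝒪[K] (Fin 3 → K) → (Fin 3 → K) → Prop) (hΛ : IsTorusEquivariantLabel σ Λ)
    (cvec : (Fin 3 → Bool) → (Fin 3 → Kˣ))
    (sEU : (Fin 3 → Bool) → (Fin 3 → Kˣ) → (Fin 3 → Kˣ)) (hsEU : ∀ e u, sEU e u = cvec e * unitNormMap σ 3 u * w⁻¹)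
    (pol : (Fin 3 → Bool) → (Fin 3 → Kˣ) → (Fin 3 → K)) (hpol : ∀ e u j, pol e u j = D₁ j * ((sEU e u j : Kˣ) : K))
    {u u' : Fin 3 → Kˣ} (hu : u ∈ unitTorus K 3) (hu' : u' ∈ unitTorus K 3) (heq : mapGL (diagGLUnits u) M₀ = mapGL (diagGLUnits u') M₀)
    (e : Fin 3 → Bool) (h : sEU e u ∈ fixedUnitStabilizer σ M₀ ∧ Λ M₀ (pol e u)) :
    sEU e u' ∈ fixedUnitStabilizer σ M₀ ∧ Λ M₀ (pol e u') := by
  have hst : u⁻¹ * u' ∈ unitStabilizer M₀ := by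
    refine Subgroup.mem_inf.2 ⟨?_, (unitTorus K 3).mul_mem ((unitTorus K 3).inv_mem hu) hu'⟩
    rw [mem_latticeStabilizer_iff, map_mul, mapGL_mul, ← heq, ← mapGL_mul, ← map_mul, inv_mul_cancel, map_one, mapGL_one]
  have hn : unitNormMap σ 3 (u⁻¹ * u') ∈ fixedUnitStabilizer σ M₀ :=
    map_unitNormMap_unitStabilizer_le hσ tv hcoset hD₁ hV₁ (Subgroup.mem_map_of_mem _ hst)
  have hu'eq : u' = u * (u⁻¹ * u') := by rw [mul_inv_cancel_left]
  rw [hu'eq, sEU_mul σ cvec sEU hsEU]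
  refine ⟨(fixedUnitStabilizer σ M₀).mul_mem h.1 hn, ?_⟩
  have hfun : pol e (u * (u⁻¹ * u')) = fun j => pol e u j * ((unitNormMap σ 3 (u⁻¹ * u') j : Kˣ) : K) :=
    funext fun j => pol_mul σ cvec sEU hsEU pol hpol e u _ j
  rw [hfun, label_mul_unitNormMap_iff Λ hΛ _ hst]
  exact h.2

open Classical in
/-- **THE LABELLED FIBRE OVER `diag(u)M₀` HAS SIZE `[s(e,u) ∈ S_F ∧ Λ(M₀, pol(e,u))]`** (it is `{a₀}` or `∅` by `labelledFibre_iff`).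
[cite: Kottwitz1986BaseChangeUnits, §1 pp. 240–241] [cite: Rogawski1990, §4.9 Prop. 4.9.1 (a) p. 55] -/
theorem ncard_labelledFibre_eq_ite {σ : K →+* K} (hσ : ∀ x, σ (σ x) = x) (hvσ : ∀ a, Valued.v (σ a) = Valued.v a)
    {ϖ : K} (hϖ : Valued.v ϖ = WithZero.exp (-1 : ℤ)) (ϖu : Kˣ) (hϖu : (ϖu : K) = ϖ)
    {c : K} (hσc : σ c = c) (hcv : Valued.v c = 1) (cU : Kˣ) (hcU : (cU : K) = c) {M₀ : Submodule 𝒪[K] (Fin 3 → K)} (tv : ℕ)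
    (hcoset : ∀ D₁ : Fin 3 → K, (∀ i, σ (D₁ i) = D₁ i ∧ D₁ i ≠ 0) → IsVertexLattice σ ϖ (Matrix.diagonal D₁) tv M₀ →
      ∀ D : Fin 3 → K, (∀ i, σ (D i) = D i ∧ D i ≠ 0) →
        (IsVertexLattice σ ϖ (Matrix.diagonal D) tv M₀ ↔ ∃ u ∈ fixedUnitStabilizer σ M₀, ∀ i, D i = D₁ i * (u i : Kˣ)))
    {D₁ : Fin 3 → K} (hD₁ : ∀ i, σ (D₁ i) = D₁ i ∧ D₁ i ≠ 0) (hV₁ : IsVertexLattice σ ϖ (Matrix.diagonal D₁) tv M₀)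
    {a₀ : Fin 3 → ℤ} {w : Fin 3 → Kˣ} (hwU : w ∈ fixedUnitTorus σ 3)
    (hD₁w : ∀ i, D₁ i = ((unitNormMap σ 3 (fun j => ϖu ^ a₀ j) i : Kˣ) : K) * ((w i : Kˣ) : K))
    (Λ : Submodule 𝒪[K] (Fin 3 → K) → (Fin 3 → K) → Prop) (hΛ : IsTorusEquivariantLabel σ Λ)
    (cvec : (Fin 3 → Bool) → (Fin 3 → Kˣ)) (hcvec : ∀ e, cvec e = fun j => if e j then cU else 1)
    (sEU : (Fin 3 → Bool) → (Fin 3 → Kˣ) → (Fin 3 → Kˣ)) (hsEU : ∀ e u, sEU e u = cvec e * unitNormMap σ 3 u * w⁻¹)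
    (pol : (Fin 3 → Bool) → (Fin 3 → Kˣ) → (Fin 3 → K)) (hpol : ∀ e u j, pol e u j = D₁ j * ((sEU e u j : Kˣ) : K))
    {u : Fin 3 → Kˣ} (hu : u ∈ unitTorus K 3) (e : Fin 3 → Bool) :
    ({a : Fin 3 → ℤ | IsVertexLattice σ ϖ (Matrix.diagonal fun j => if e j then c else (1 : K)) tv
          (mapGL (diagGLUnits fun j => ϖu ^ a j) (mapGL (diagGLUnits u) M₀)) ∧
        Λ (mapGL (diagGLUnits fun j => ϖu ^ a j) (mapGL (diagGLUnits u) M₀)) (fun j => if e j then c else (1 : K))} : Set _).ncard =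
      if (sEU e u ∈ fixedUnitStabilizer σ M₀ ∧ Λ M₀ (pol e u)) then 1 else 0 := by
  have step2 := labelledFibre_iff hσ hvσ hϖ ϖu hϖu hσc hcv cU hcU tv hcoset hD₁ hV₁ hwU hD₁w Λ hΛ cvec hcvec sEU hsEU pol hpol hu e
  by_cases hq : sEU e u ∈ fixedUnitStabilizer σ M₀ ∧ Λ M₀ (pol e u)
  · rw [if_pos hq]
    have hset : ({a : Fin 3 → ℤ | IsVertexLattice σ ϖ (Matrix.diagonal fun j => if e j then c else (1 : K)) tv
          (mapGL (diagGLUnits fun j => ϖu ^ a j) (mapGL (diagGLUnits u) M₀)) ∧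
        Λ (mapGL (diagGLUnits fun j => ϖu ^ a j) (mapGL (diagGLUnits u) M₀)) (fun j => if e j then c else (1 : K))} : Set _) = {a₀} := by
      ext a
      rw [Set.mem_setOf_eq, step2 a, Set.mem_singleton_iff]
      exact ⟨fun h => h.1, fun h => ⟨h, hq⟩⟩
    rw [hset, Set.ncard_singleton]
  · rw [if_neg hq]
    have hset : ({a : Fin 3 → ℤ | IsVertexLattice σ ϖ (Matrix.diagonal fun j => if e j then c else (1 : K)) tv
          (mapGL (diagGLUnits fun j => ϖu ^ a j) (mapGL (diagGLUnits u) M₀)) ∧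
        Λ (mapGL (diagGLUnits fun j => ϖu ^ a j) (mapGL (diagGLUnits u) M₀)) (fun j => if e j then c else (1 : K))} : Set _) = ∅ := by
      ext a
      rw [Set.mem_setOf_eq, step2 a, Set.mem_empty_iff_false, iff_false]
      exact fun h => hq h.2
    rw [hset, Set.ncard_empty]

open Classical in
/-- **THE ORBIT SUM OF THE LABELLED FIBRE SIZES AT SIGN `e` IS THE NUMBER OF GOOD ORBIT MEMBERS** `#{diag(u)M₀ : s(e,u) ∈ S_F ∧ Λ(M₀, pol(e,u))}` (★ (O2b) Step 4, one
sign at a time: each fibre is `{a₀}` or `∅`). [cite: Kottwitz1986BaseChangeUnits, §1 pp. 240–241] [cite: Rogawski1990, §4.9 Prop. 4.9.1 (a) p. 55] -/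
theorem finsum_ncard_labelledFibre_eq_ncard {σ : K →+* K} (hσ : ∀ x, σ (σ x) = x) (hvσ : ∀ a, Valued.v (σ a) = Valued.v a)
    {ϖ : K} (hϖ : Valued.v ϖ = WithZero.exp (-1 : ℤ)) (ϖu : Kˣ) (hϖu : (ϖu : K) = ϖ)
    {c : K} (hσc : σ c = c) (hcv : Valued.v c = 1) (cU : Kˣ) (hcU : (cU : K) = c) {M₀ : Submodule 𝒪[K] (Fin 3 → K)}
    (hfin : {M : Submodule 𝒪[K] (Fin 3 → K) | ∃ u ∈ unitTorus K 3, M = mapGL (diagGLUnits u) M₀}.Finite) (tv : ℕ)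
    (hcoset : ∀ D₁ : Fin 3 → K, (∀ i, σ (D₁ i) = D₁ i ∧ D₁ i ≠ 0) → IsVertexLattice σ ϖ (Matrix.diagonal D₁) tv M₀ →
      ∀ D : Fin 3 → K, (∀ i, σ (D i) = D i ∧ D i ≠ 0) →
        (IsVertexLattice σ ϖ (Matrix.diagonal D) tv M₀ ↔ ∃ u ∈ fixedUnitStabilizer σ M₀, ∀ i, D i = D₁ i * (u i : Kˣ)))
    {D₁ : Fin 3 → K} (hD₁ : ∀ i, σ (D₁ i) = D₁ i ∧ D₁ i ≠ 0) (hV₁ : IsVertexLattice σ ϖ (Matrix.diagonal D₁) tv M₀)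
    {a₀ : Fin 3 → ℤ} {w : Fin 3 → Kˣ} (hwU : w ∈ fixedUnitTorus σ 3)
    (hD₁w : ∀ i, D₁ i = ((unitNormMap σ 3 (fun j => ϖu ^ a₀ j) i : Kˣ) : K) * ((w i : Kˣ) : K))
    (Λ : Submodule 𝒪[K] (Fin 3 → K) → (Fin 3 → K) → Prop) (hΛ : IsTorusEquivariantLabel σ Λ)
    (cvec : (Fin 3 → Bool) → (Fin 3 → Kˣ)) (hcvec : ∀ e, cvec e = fun j => if e j then cU else 1)
    (sEU : (Fin 3 → Bool) → (Fin 3 → Kˣ) → (Fin 3 → Kˣ)) (hsEU : ∀ e u, sEU e u = cvec e * unitNormMap σ 3 u * w⁻¹)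
    (pol : (Fin 3 → Bool) → (Fin 3 → Kˣ) → (Fin 3 → K)) (hpol : ∀ e u j, pol e u j = D₁ j * ((sEU e u j : Kˣ) : K)) (e : Fin 3 → Bool) :
    (∑ᶠ M ∈ {M : Submodule 𝒪[K] (Fin 3 → K) | ∃ u ∈ unitTorus K 3, M = mapGL (diagGLUnits u) M₀},
        ({a : Fin 3 → ℤ | IsVertexLattice σ ϖ (Matrix.diagonal fun j => if e j then c else (1 : K)) tv (mapGL (diagGLUnits fun j => ϖu ^ a j) M) ∧
          Λ (mapGL (diagGLUnits fun j => ϖu ^ a j) M) (fun j => if e j then c else (1 : K))} : Set _).ncard) =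
      ({M | ∃ u ∈ unitTorus K 3, M = mapGL (diagGLUnits u) M₀ ∧ (sEU e u ∈ fixedUnitStabilizer σ M₀ ∧ Λ M₀ (pol e u))} : Set _).ncard := by
  have hBsub : ({M | ∃ u ∈ unitTorus K 3, M = mapGL (diagGLUnits u) M₀ ∧ (sEU e u ∈ fixedUnitStabilizer σ M₀ ∧ Λ M₀ (pol e u))} : Set _) ⊆
      {M : Submodule 𝒪[K] (Fin 3 → K) | ∃ u ∈ unitTorus K 3, M = mapGL (diagGLUnits u) M₀} := by
    rintro M ⟨u, hu, rfl, -⟩; exact ⟨u, hu, rfl⟩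
  have hmemB : ∀ u ∈ unitTorus K 3, mapGL (diagGLUnits u) M₀ ∈ ({M | ∃ u ∈ unitTorus K 3, M = mapGL (diagGLUnits u) M₀ ∧
      (sEU e u ∈ fixedUnitStabilizer σ M₀ ∧ Λ M₀ (pol e u))} : Set _) ↔ (sEU e u ∈ fixedUnitStabilizer σ M₀ ∧ Λ M₀ (pol e u)) := by
    intro u hu
    constructor
    · rintro ⟨u', hu', heq, h⟩; exact labelledCond_of_mapGL_eq hσ tv hcoset hD₁ hV₁ Λ hΛ cvec sEU hsEU pol hpol hu' hu heq.symm e h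
    · intro h; exact ⟨u, hu, rfl, h⟩
  rw [finsum_mem_eq_finite_toFinset_sum _ hfin]
  have hstep : ∀ M ∈ hfin.toFinset, ({a : Fin 3 → ℤ |
      IsVertexLattice σ ϖ (Matrix.diagonal fun j => if e j then c else (1 : K)) tv (mapGL (diagGLUnits fun j => ϖu ^ a j) M) ∧
        Λ (mapGL (diagGLUnits fun j => ϖu ^ a j) M) (fun j => if e j then c else (1 : K))} : Set _).ncard =
      if M ∈ ({M | ∃ u ∈ unitTorus K 3, M = mapGL (diagGLUnits u) M₀ ∧ (sEU e u ∈ fixedUnitStabilizer σ M₀ ∧ Λ M₀ (pol e u))} : Set _) then 1 else 0 := by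
    intro M hM
    obtain ⟨u, hu, rfl⟩ := (Set.Finite.mem_toFinset hfin).1 hM
    rw [ncard_labelledFibre_eq_ite hσ hvσ hϖ ϖu hϖu hσc hcv cU hcU tv hcoset hD₁ hV₁ hwU hD₁w Λ hΛ cvec hcvec sEU hsEU pol hpol hu e]
    exact if_congr (hmemB u hu).symm rfl rfl
  rw [Finset.sum_congr rfl hstep, Finset.sum_boole, Nat.cast_id, Set.ncard_eq_toFinset_card _ (hfin.subset hBsub)]
  congr 1
  ext M
  simp only [Finset.mem_filter, Set.Finite.mem_toFinset]
  exact ⟨fun h => h.2, fun h => ⟨hBsub h, h⟩⟩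

end Summit.HodgeConjecture.HodgeConjecture.Cruxes.H413.F0P3cDyRamDiagonalLabelledOddFibreStep

end
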